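import Summits.NavierStokesRegularity.NavierStokesRegularity.Theorems.ScenarioCensusFloquetMeterRow
import Summits.NavierStokesRegularity.NavierStokesRegularity.Theorems.ScenarioCensusModeRankShell
import Summits.NavierStokesRegularity.NavierStokesRegularity.Theorems.ScenarioCensusCharacterMeter
import HarnessLib

/-!
# LINE «floquet-meter» port, part 3/3: decided sub-cells by nesting `Row_A1e1` / `Row_A1cx0` / `Row_A1cx` (§F), the OPEN head `Row_A1fr` and next cell `Row_A1fs` (§G);
# census KEYS `Row_A1fm` / `Row_A1e1` / `Row_A1cx0` / `Row_A1cx` + `_excluded`, `Row_A1fr` / `Row_A1fs` (OPEN), edge `row_A1fm_of_row_P1pm`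

Re-homed for the scenario census (typer seat ns-census-typer-1 g8; the cells A1fm / A1e1 / A1cx0 are MEMBERS OF RECORD «DECIDED IN KERNEL IN FILES» of row A1apT
since census v1.72 (critic idea-crit-3 g7 PASS 23:21:11Z; ref ns-census-ref g9 PRE-CHECK ✓ §14.18 item 30; lead-presearch label), A1cx since v1.71 (temporal-spectrum
REV 4; restated VERBATIM here and decided by nesting); this port makes them TREE-decided): VERBATIM PORT of ns-idea-2 LINE g13-1 «floquet-meter» REV 1,
`pub/ideators/ns-idea-2/lines/floquet-meter/line-floquet-meter.lean` sha16 add9e8af7413777b (750 l., lean check rc 0, 0 sorry), split for the 400-line rule into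
`ScenarioCensusFloquetMeter` (§A–§D) → `…FloquetMeterRow` (§E) → `…FloquetMeterCells` (§F–§G + census KEYS).  Lean text VERBATIM in namespace
`…Theorems.ScenarioCensus.FloquetMeter` (the line's `…Lines.FloquetMeter` re-homed); port edits: `local notation "E3"` → `abbrev E3` (typer lint: no notation in
port files), `@[conjecture]` on the OPEN head `Row_A1fr` and next cell `Row_A1fs` (typed only), seven one-line docstrings added (gate lint); the one deprecated lemma name at the kit's l.503
(`ContinuousLinearMap.coe_smul'` → `FunLike.coe_smul`, the replacement the linter names — exactly the line's REV 2 file bb1b268c071fb3ef, its only difference) is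
used (proof text only); the §A lemmas the line
shares verbatim with «mode-rank» are taken BY NAME from the landed mode-rank port (listed below), `tendsto_typeI_bound` is not re-declared (used only there) and
the coordinate bound `abs_apply_le_norm'` (twin of landed Literature lemmas) is replaced at its one use by Mathlib's `PiLp.norm_apply_le` (proof text only).
Statements untouched.

No census VALUE is moved here (row A1apT keeps its value; the members become TREE-decided by name); NS regularity is NOT proved; (L′) ⟨10661⟩ is
untouched; no summit statement is proved by this file. Lemmas that restate already-landed tree declarations are taken BY NAME (gate lint `dedup.landed`): `apply_eq_apply_of_harmonic_bounded` = `ModeRank.apply_eq_apply_of_harmonic_bounded`, `apply_eq_apply_of_curl_const` = `ModeRank.apply_eq_apply_of_curl_const`, `tendsto_slice_atBot` = `ModeRank.tendsto_slice_atBot`, `eq_zero_of_curl_slice_const` = `ModeRank.eq_zero_of_curl_slice_const`.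
-/

-- the summit and its single problem share the name `NavierStokesRegularity` (D-0017 nested layout)
set_option linter.dupNamespace false

noncomputable section

open Set Function Filter Topology

namespace Summit.NavierStokesRegularity.NavierStokesRegularity.Theorems.ScenarioCensus.FloquetMeter

open Literature.Analysis Literature.Analysis.FluidPDE InnerProductSpace
open Summit.NavierStokesRegularity.NavierStokesRegularity.Theorems (vorticity_eq_deriv_of_typeI)
open scoped Laplacian InnerProductSpace RealInnerProductSpace ContDiff

/-! ## F. Decided sub-cells by NESTING: one exponential mode, one oscillatory pair (the companion line
«temporal-spectrum»'s REV 2 cell `Row_A1cx`, here WITHOUT any hypothesis on the profiles) -/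

/-- **Row A1e1 (one real exponential mode, arbitrary profile)**: `u(t,x) = e^{σt} φ(x)` on `t < 0` with
ANY `φ : ℝ³ → ℝ³` (no regularity, decay or curl hypothesis) ⇒ `u ≡ 0`.  A face of `Row_A1fm`
(`τ = 1`, `μ = e^{σ}`). -/
def Row_A1e1 : Prop :=
  ∀ (C : ℝ) (u : ℝ → E3 → E3), IsTypeIAncientMild C u →
    ∀ (σ : ℝ) (φ : E3 → E3), (∀ t < 0, ∀ x, u t x = Real.exp (σ * t) • φ x) →
      ∀ t < 0, ∀ x, u t x = 0

/-- A1e1 from A1fm (nesting: one exponential mode is one Floquet multiplier for every step). -/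
theorem row_A1e1_of_row_A1fm (h : Row_A1fm) : Row_A1e1 := by
  intro C u hu σ φ hsl
  refine h C u hu 1 (Real.exp σ) one_pos fun t ht x => ?_
  have ht' : t < 0 := by linarith
  rw [hsl (t + 1) ht x, hsl t ht' x, smul_smul, ← Real.exp_add]
  congr 1; ring_nf

/-- **Row A1cx0 (one oscillatory pair of rates `a ± ib`, arbitrary profiles)**: on `t < 0`,
`u(t,x) = e^{at}(cos(bt) ψ(x) + sin(bt) χ(x))` with `b ≠ 0` and ANY `ψ, χ : ℝ³ → ℝ³` ⇒ `u ≡ 0`.  A face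
of `Row_A1fm` (`τ = 2π/|b|`, `μ = e^{aτ}`): the companion line's ~400-line rotating-shell argument for
`Row_A1cx` is ONE instance of the Floquet meter, and the profile hypotheses there are not needed. -/
def Row_A1cx0 : Prop :=
  ∀ (C : ℝ) (u : ℝ → E3 → E3), IsTypeIAncientMild C u →
    ∀ (a b : ℝ) (ψ χ : E3 → E3), b ≠ 0 →
      (∀ t < 0, ∀ x, u t x =
        Real.exp (a * t) • (Real.cos (b * t) • ψ x + Real.sin (b * t) • χ x)) →
      ∀ t < 0, ∀ x, u t x = 0

/-- A1cx0 from A1fm (nesting: one oscillatory pair has the Floquet multiplier `e^{2πa/|b|}` for the step `2π/|b|`). -/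
theorem row_A1cx0_of_row_A1fm (h : Row_A1fm) : Row_A1cx0 := by
  intro C u hu a b ψ χ hb hsl
  have hbabs : 0 < |b| := abs_pos.2 hb
  set τ : ℝ := 2 * Real.pi / |b| with hτdef
  have hτ : 0 < τ := div_pos Real.two_pi_pos hbabs
  refine h C u hu τ (Real.exp (a * τ)) hτ fun t ht x => ?_
  have ht' : t < 0 := by linarith
  have hcos : Real.cos (b * (t + τ)) = Real.cos (b * t) := by
    rcases lt_or_gt_of_ne hb with hneg | hpos
    · have hτ' : b * τ = -(2 * Real.pi) := by
        rw [hτdef, abs_of_neg hneg]; field_simp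
      rw [mul_add, hτ', ← sub_eq_add_neg, Real.cos_sub_two_pi]
    · have hτ' : b * τ = 2 * Real.pi := by
        rw [hτdef, abs_of_pos hpos]; field_simp
      rw [mul_add, hτ', Real.cos_add_two_pi]
  have hsin : Real.sin (b * (t + τ)) = Real.sin (b * t) := by
    rcases lt_or_gt_of_ne hb with hneg | hpos
    · have hτ' : b * τ = -(2 * Real.pi) := by
        rw [hτdef, abs_of_neg hneg]; field_simp
      rw [mul_add, hτ', ← sub_eq_add_neg, Real.sin_sub_two_pi]
    · have hτ' : b * τ = 2 * Real.pi := by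
        rw [hτdef, abs_of_pos hpos]; field_simp
      rw [mul_add, hτ', Real.sin_add_two_pi]
  rw [hsl (t + τ) ht x, hsl t ht' x, hcos, hsin, smul_smul, ← Real.exp_add]
  congr 1; ring_nf

/-- Row A1cx of line «temporal-spectrum» (REV 2), restated VERBATIM for the nesting record. -/
def Row_A1cx : Prop :=
  ∀ (C : ℝ) (u : ℝ → E3 → E3), IsTypeIAncientMild C u →
    ∀ (a b : ℝ) (ψ χ : E3 → E3), b ≠ 0 → ContDiff ℝ 3 ψ → ContDiff ℝ 3 χ →
      (∃ A : ℝ, ∀ x, ‖curl ψ x‖ ≤ A) → (∃ A : ℝ, ∀ x, ‖curl χ x‖ ≤ A) →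
      (∀ t < 0, ∀ x, u t x =
        Real.exp (a * t) • (Real.cos (b * t) • ψ x + Real.sin (b * t) • χ x)) →
      ∀ t < 0, ∀ x, u t x = 0

/-- A1cx from A1cx0 (drop the regularity hypotheses). -/
theorem row_A1cx_of_row_A1cx0 (h : Row_A1cx0) : Row_A1cx :=
  fun C u hu a b ψ χ hb _ _ _ _ hsl => h C u hu a b ψ χ hb hsl

/-- **Row A1e1 holds.** -/
theorem row_A1e1_holds : Row_A1e1 := row_A1e1_of_row_A1fm row_A1fm_holds
/-- **Row A1cx0 holds.** -/
theorem row_A1cx0_holds : Row_A1cx0 := row_A1cx0_of_row_A1fm row_A1fm_holds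
/-- **Row A1cx holds** (decided by nesting in A1fm). -/
theorem row_A1cx_holds : Row_A1cx := row_A1cx_of_row_A1cx0 row_A1cx0_holds

/-! ## G. The head and the next cell of the meter (typed, OPEN) -/

/-- **Row A1fr (THE HEAD: finite Floquet spectrum in operator form — a constant-coefficient linear
RECURRENCE in time, common to all `x`)**: if for some step `τ > 0`, order `d` and coefficients `cⱼ`
every time signal satisfies `u(t + dτ, x) = ∑_{j<d} cⱼ u(t + jτ, x)` whenever `t + dτ < 0`, then
`u ≡ 0`.  OPEN (typed).  `d = 1` is `Row_A1fm` (`row_A1fm_of_row_A1fr`); for `d ≥ 2` the multipliers are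
the roots of `X^d - ∑ cⱼ X^j`: a complex root with argument commensurable to `π` reduces to `Row_A1fm`
with a longer step, several real roots are the next cell `Row_A1fs`, and an incommensurable complex pair
(QUASI-PERIODIC amplitude) is the instrument row that would refute the lever. -/
@[conjecture] def Row_A1fr : Prop :=
  ∀ (C : ℝ) (u : ℝ → E3 → E3), IsTypeIAncientMild C u →
    ∀ (τ : ℝ) (d : ℕ) (c : Fin d → ℝ), 0 < τ →
      (∀ t : ℝ, t + d * τ < 0 → ∀ x, u (t + d * τ) x = ∑ j : Fin d, c j • u (t + (j : ℕ) * τ) x) →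
      ∀ t < 0, ∀ x, u t x = 0

/-- The head A1fr implies A1fm (`d = 1`). -/
theorem row_A1fm_of_row_A1fr (h : Row_A1fr) : Row_A1fm := by
  intro C u hu τ μ hτ hfl
  refine h C u hu τ 1 ![μ] hτ fun t ht x => ?_
  have ht1 : t + τ < 0 := by simpa using ht
  simpa using hfl t ht1 x

/-- **Row A1fs (finite simple real Floquet spectrum, explicit form — the NEXT CELL, OPEN, typed)**: on
`t < 0`, `u(t,x) = ∑ₖ e^{aₖ t} Pₖ(t,x)` with finitely many DISTINCT real rates `aₖ` and `τ`-PERIODIC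
profiles `Pₖ` (jointly smooth on the slab `t < 0`, with bounded curls) ⇒ `u ≡ 0`.  Planned proof (REV 2):
dominant balance at `-∞` with PERIODIC coefficients (a periodic function tending to `0` vanishes) kills the
rates `aₖ ≤ 0`; the vorticity identity on the ansatz is a finite sum `∑ e^{rt} G_r(t,x)` with `τ`-periodic
groups, separated by the same lemma; at the minimal vorticity-carrying rate `a⋆ > 0` the quadratic group is
empty by exponent bookkeeping and the linear group reads `a⋆Ω⋆ + ∂ₜΩ⋆ = ΔΩ⋆` with `Ω⋆` periodic and bounded
— emptied by `periodic_parabolic_barrier`; then the gauge.  (`n = 1`, `P` periodic = the `μ > 0` face of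
`Row_A1fm`.) -/
@[conjecture] def Row_A1fs : Prop :=
  ∀ (C : ℝ) (u : ℝ → E3 → E3), IsTypeIAncientMild C u →
    ∀ (τ : ℝ) (n : ℕ) (a : Fin n → ℝ) (P : Fin n → ℝ → E3 → E3), 0 < τ → Function.Injective a →
      (∀ k, IsSmoothSpaceTimeOn (Iio 0) (P k)) →
      (∀ k (t : ℝ), t + τ < 0 → ∀ x, P k (t + τ) x = P k t x) →
      (∀ k, ∃ A : ℝ, ∀ t < 0, ∀ x, ‖curl (P k t) x‖ ≤ A) →
      (∀ t < 0, ∀ x, u t x = ∑ k, Real.exp (a k * t) • P k t x) →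
      ∀ t < 0, ∀ x, u t x = 0

end Summit.NavierStokesRegularity.NavierStokesRegularity.Theorems.ScenarioCensus.FloquetMeter

namespace Summit.NavierStokesRegularity.NavierStokesRegularity.Theorems.ScenarioCensus

/-! ## Census KEYS (ns `…Theorems.ScenarioCensus`): instrument FLOQUET METER on row A1apT — TREE-decided members A1fm / A1e1 / A1cx0 / A1cx, OPEN head A1fr / next cell A1fs -/

/-- **Cell A1fm** (one Floquet multiplier of the time-`τ` shift: `u(t+τ,·) = μ u(t,·)` for `t + τ < 0`, `τ > 0`, `μ ∈ ℝ` ⇒ `u ≡ 0`): `:= FloquetMeter.Row_A1fm`. DECIDED (also re-decided by the character method, `CharacterMeter.row_A1fm_bis`). -/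
def Row_A1fm : Prop := FloquetMeter.Row_A1fm
/-- A1fm is EXCLUDED (decided in the tree): `FloquetMeter.row_A1fm_holds`. -/
theorem row_A1fm_excluded : Row_A1fm := FloquetMeter.row_A1fm_holds

/-- **Cell A1e1** (one exponential mode `u = e^{at} φ(x)`): `:= FloquetMeter.Row_A1e1`. DECIDED (nesting in A1fm). -/
def Row_A1e1 : Prop := FloquetMeter.Row_A1e1
/-- A1e1 is EXCLUDED (decided in the tree): `FloquetMeter.row_A1e1_holds`. -/
theorem row_A1e1_excluded : Row_A1e1 := FloquetMeter.row_A1e1_holds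

/-- **Cell A1cx0** (one oscillatory pair `e^{at}(cos bt ψ + sin bt χ)`, `b ≠ 0`, no regularity hypotheses): `:= FloquetMeter.Row_A1cx0`. DECIDED (nesting in A1fm). -/
def Row_A1cx0 : Prop := FloquetMeter.Row_A1cx0
/-- A1cx0 is EXCLUDED (decided in the tree): `FloquetMeter.row_A1cx0_holds`. -/
theorem row_A1cx0_excluded : Row_A1cx0 := FloquetMeter.row_A1cx0_holds

/-- **Cell A1cx** (one oscillatory mode pair with `C³` profiles of bounded curl — VERBATIM the cell of LINE «temporal-spectrum» REV 4, member of record since v1.71): `:= FloquetMeter.Row_A1cx`. DECIDED (nesting in A1cx0). -/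
def Row_A1cx : Prop := FloquetMeter.Row_A1cx
/-- A1cx is EXCLUDED (decided in the tree): `FloquetMeter.row_A1cx_holds`. -/
theorem row_A1cx_excluded : Row_A1cx := FloquetMeter.row_A1cx_holds

/-- **Row A1fr** (the HEAD: finite Floquet spectrum — a constant-coefficient linear recurrence in time ⇒ `u ≡ 0`) — typed only: `:= FloquetMeter.Row_A1fr`. OPEN (no witness, no proof). -/
@[conjecture] def Row_A1fr : Prop := FloquetMeter.Row_A1fr

/-- **Row A1fs** (finite simple real Floquet spectrum with `τ`-periodic profiles ⇒ `u ≡ 0`) — typed only: `:= FloquetMeter.Row_A1fs`. OPEN (no witness, no proof). -/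
@[conjecture] def Row_A1fs : Prop := FloquetMeter.Row_A1fs

/-- Lattice edge at key level: the OPEN head A1fr implies the decided cell A1fm (`FloquetMeter.row_A1fm_of_row_A1fr`). -/
theorem row_A1fm_of_row_A1fr : Row_A1fr → Row_A1fm := FloquetMeter.row_A1fm_of_row_A1fr
/-- Lattice edge at key level: the OPEN modulated-multiplier row P1pm (character-meter port) implies A1fm — `CharacterMeter.row_A1fm_of_row_P1pm`, transported along
the definitional equality of the character-meter's VERBATIM restatement `CharacterMeter.Row_A1fm` with `FloquetMeter.Row_A1fm`. -/
theorem row_A1fm_of_row_P1pm : Row_P1pm → Row_A1fm := fun h => CharacterMeter.row_A1fm_of_row_P1pm h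
/-- Display: the character-meter's re-decision `row_A1fm_bis` proves the same cell (the two `Row_A1fm` statements are VERBATIM identical). -/
theorem row_A1fm_excluded' : Row_A1fm := CharacterMeter.row_A1fm_bis

end Summit.NavierStokesRegularity.NavierStokesRegularity.Theorems.ScenarioCensus

end
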